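import Summits.ValiantsHypothesis.ValiantsHypothesis.Theorems.BarrierLeverNPCorpusChain
import Summits.ValiantsHypothesis.ValiantsHypothesis.Theorems.BarrierLeverKRSTResidualBandOfVNP

/-!
# Route BarrierLever — item `NaturalProofsSeparateVNP` (stmt-ValiantsHypothesis-18972):
# EXPONENT COLLAPSE — the item's `∃ b₁` is decided at `b₁ = 1`

`S := Theses.BarrierLever.NaturalProofsSeparateVNP` is `∃ b₁, WinWin.NaturalProofsSeparate b₁`
("for every `b`, infinitely often in `n`, a level-one natural proof against `SmallCircuits ℂ n b` is
nonzero at some member of the `VNP`-succinct class `SmallDefinable ℂ n b₁`").  This helper file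
(`--supports` the item; it closes nothing) proves

* `separate_one_of_separate` : `WinWin.NaturalProofsSeparate b₁ → WinWin.NaturalProofsSeparate 1`;
* `naturalProofsSeparateVNP_iff_separate_one` : hence `S ↔ WinWin.NaturalProofsSeparate 1`.

So the VNP-side exponent of the item collapses exactly as the distinguisher level of the crux does
(`SuccinctHittingSetsForVP.succinctHittingSetsForVP_iff_levelOne`): a refuter or prover of item
18972 may work at `b₁ = 1` only.

**Proof (polynomial stretch `n ↦ m = n^(b₁+1)`).** Given, at `n` variables, a level-one natural
proof `D` against `SmallCircuits ℂ n b` (for the `b` of our choice — the hypothesis holds for every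
`b`) that is nonzero at `g ∈ SmallDefinable ℂ n b₁`:
(i) `g` renamed along `Fin n ↪ Fin m` lies in `SmallDefinable ℂ m 1` as soon as `n, n^b₁ ≤ m`
(`rename_mem_smallDefinable_one`; Boolean sums commute with renaming, `boolSum_rename_sumMap`);
(ii) `D` renamed along the zero-padding of exponent vectors (`LevelOne.mapsTo_pad`) is a level-one
distinguisher in the `C(2m,m)` coefficient variables (central binomials are monotone,
`centralBinom_mono`), still nonzero, and it VANISHES on `SmallCircuits ℂ m b'` because every
`f' ∈ SmallCircuits ℂ m b'` shadows to an `f ∈ SmallCircuits ℂ n (K b' + K + 6)` (`K = b₁ + 1`,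
`m ≤ n^K`, `n ≥ 4`) with the same coefficients on the padded monomials — kill the extra variables
and truncate to degree `≤ n` (the landed `StubRestrict.exists_kill` / `exists_truncate` of the
crux's level-collapse file, here with a polynomial instead of a `3n` stretch: `restrict_stretch`);
so choosing `b := K b' + K + 6` makes `D` kill the shadow (`isNaturalProof_rename_pad`);
(iii) the padded `D` at the padded `g` evaluates to `D(coeff g) ≠ 0` (`eval_rename_pad`).

WHAT THIS IS NOT: not a proof or refutation of item 18972 (which implies the summit AND refutes
FSV Question 6, `valiantsHypothesis_and_not_crux_of_naturalProofsSeparateVNP`); nothing here bears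
on `VP ≠ VNP`.

References: [ForbesShpilkaVolk2018] Def. 1, Cor. 5, Question 6 (framework; padding bookkeeping is
folklore inside it); [KumarRamyaSaptharishiTengse2022] §1.2 (the `VNP`-succinct class).
-/

-- layout Summits/ValiantsHypothesis/ValiantsHypothesis forces the duplicated namespace component
set_option linter.dupNamespace false

noncomputable section

namespace Summit.ValiantsHypothesis.ValiantsHypothesis.Theorems.BarrierLever.NaturalProofsSeparateVNP

open Literature.Barriers.ValiantsHypothesis Literature.Computability.AlgebraicComplexity MvPolynomial
open Summit.ValiantsHypothesis.ValiantsHypothesis.Theorems.BarrierLever.SuccinctHittingSetsForVP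
open Summit.ValiantsHypothesis.ValiantsHypothesis.Theses

/-! ### Arithmetic -/

/-- Central binomial coefficients are monotone: `C(2n,n) ≤ C(2m,m)` for `n ≤ m`
(from `(k+1) C(2k+2,k+1) = 2(2k+1) C(2k,k)`). [folklore] -/
theorem centralBinom_mono {n m : ℕ} (h : n ≤ m) : (2 * n).choose n ≤ (2 * m).choose m := by
  rw [← Nat.centralBinom_eq_two_mul_choose, ← Nat.centralBinom_eq_two_mul_choose]
  induction m, h using Nat.le_induction with
  | base => exact le_rfl
  | succ k _ ih =>
    refine ih.trans (Nat.le_of_mul_le_mul_left ?_ (Nat.succ_pos k))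
    rw [Nat.succ_mul_centralBinom_succ]
    exact Nat.mul_le_mul_right _ (by omega)

/-- The size bookkeeping of the polynomial stretch: for `n ≥ 4`, `m ≤ n^K` (`K ≥ 1`) and
`c ≤ n^(K b')`, `(n+1)((m+1)(c+n+2)) + (n+1) ≤ n^(K b' + K + 6)`. [folklore] -/
theorem stretch_arith {n m K b' c : ℕ} (hn : 4 ≤ n) (hK : 1 ≤ K) (hm : m ≤ n ^ K)
    (hc : c ≤ n ^ (K * b')) :
    (n + 1) * ((m + 1) * (c + n + 2)) + (n + 1) ≤ n ^ (K * b' + K + 6) := by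
  have hn1 : 1 ≤ n := by omega
  have hpos : ∀ e : ℕ, 1 ≤ n ^ e := fun e => Nat.one_le_pow e n hn1
  have h1 : n + 1 ≤ n ^ 2 := by nlinarith
  have h2 : m + 1 ≤ n ^ (K + 1) := by
    calc m + 1 ≤ n ^ K + n ^ K := Nat.add_le_add hm (hpos K)
      _ = 2 * n ^ K := by ring
      _ ≤ n * n ^ K := Nat.mul_le_mul_right _ (by omega)
      _ = n ^ (K + 1) := by ring
  have h3 : c + n + 2 ≤ n ^ (K * b' + 2) := by
    have hE := hpos (K * b')
    calc c + n + 2 ≤ n ^ (K * b') + n ^ (K * b') * n + 2 * n ^ (K * b') := by nlinarith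
      _ = n ^ (K * b') * (n + 3) := by ring
      _ ≤ n ^ (K * b') * n ^ 2 := Nat.mul_le_mul_left _ (by nlinarith)
      _ = n ^ (K * b' + 2) := by ring
  have hmain : (n + 1) * ((m + 1) * (c + n + 2)) ≤ n ^ (K * b' + K + 5) := by
    calc (n + 1) * ((m + 1) * (c + n + 2)) ≤ n ^ 2 * (n ^ (K + 1) * n ^ (K * b' + 2)) :=
          Nat.mul_le_mul h1 (Nat.mul_le_mul h2 h3)
      _ = n ^ (K * b' + K + 5) := by ring
  have htail : n + 1 ≤ n ^ (K * b' + K + 5) :=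
    h1.trans (Nat.pow_le_pow_right hn1 (by omega))
  calc (n + 1) * ((m + 1) * (c + n + 2)) + (n + 1)
      ≤ n ^ (K * b' + K + 5) + n ^ (K * b' + K + 5) := Nat.add_le_add hmain htail
    _ = 2 * n ^ (K * b' + K + 5) := by ring
    _ ≤ n * n ^ (K * b' + K + 5) := Nat.mul_le_mul_right _ (by omega)
    _ = n ^ (K * b' + K + 6) := by ring

/-! ### The `VP` side: shadowing along a polynomial stretch -/

/-- **Projection–truncation along a polynomial stretch** (the crux file's `stub_restrict` with
`m ≤ n^K` in place of `m ≤ 3n`): for `4 ≤ n ≤ m ≤ n^K`, every `f' ∈ SmallCircuits ℂ m b'` has a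
shadow `f ∈ SmallCircuits ℂ n (K b' + K + 6)` with the same coefficients on the zero-padded
monomials of degree `≤ n` — kill the variables beyond `n` (`StubRestrict.exists_kill`), then keep
the homogeneous components of degree `≤ n` (`StubRestrict.exists_truncate`).
[cite: ForbesShpilkaVolk2018, Cor. 5] -/
theorem restrict_stretch {n m K b' : ℕ} (hn : 4 ≤ n) (hK : 1 ≤ K) (hnm : n ≤ m) (hmK : m ≤ n ^ K)
    (f' : MvPolynomial (Fin m) ℂ) (hf' : f' ∈ SmallCircuits ℂ m b') :
    ∃ f ∈ SmallCircuits ℂ n (K * b' + K + 6),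
      ∀ μ : Fin n →₀ ℕ, μ.degree ≤ n → coeff μ f = coeff (μ.mapDomain (Fin.castLE hnm)) f' := by
  obtain ⟨g₀, hgc, hgd, hgm⟩ := StubRestrict.exists_kill hnm f'
  obtain ⟨f, hfd, hfc, hfm⟩ := StubRestrict.exists_truncate g₀ (hgd.trans hf'.1) n
  refine ⟨f, ⟨hfd, hfc.trans (stretch_arith hn hK hmK ?_)⟩, fun μ hμ => (hfm μ hμ).trans (hgm μ)⟩
  calc complexity g₀ ≤ complexity f' := hgc
    _ ≤ m ^ b' := hf'.2
    _ ≤ (n ^ K) ^ b' := Nat.pow_le_pow_left hmK b'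
    _ = n ^ (K * b') := by rw [← pow_mul]

/-! ### The distinguisher side: padding a level-one natural proof -/

/-- **Transport of a level-one natural proof along the stretch.** For `4 ≤ n ≤ m ≤ n^K`, a
level-one natural proof at `n` variables against `SmallCircuits ℂ n (K b' + K + 6)`, renamed along
the zero-padding of exponent vectors, is a level-one natural proof at `m` variables against
`SmallCircuits ℂ m b'`: size and degree do not grow under `rename` and `C(2n,n) ≤ C(2m,m)`; it
stays nonzero (`rename` along an injection); and it kills every `f' ∈ SmallCircuits ℂ m b'` through
the shadow of `restrict_stretch`. [cite: ForbesShpilkaVolk2018, Def. 1 and Cor. 5] -/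
theorem isNaturalProof_rename_pad {n m K b' : ℕ} (hn : 4 ≤ n) (hK : 1 ≤ K) (hnm : n ≤ m)
    (hmK : m ≤ n ^ K) {D : MvPolynomial (degLEMonomials n) ℂ}
    (hD : IsNaturalProof (degLEMonomials n) (SmallCircuits ℂ n (K * b' + K + 6))
      (Distinguishers ℂ n 1) D) :
    IsNaturalProof (degLEMonomials m) (SmallCircuits ℂ m b') (Distinguishers ℂ m 1)
      (rename ((LevelOne.mapsTo_pad hnm).restrict _ _ _) D) := by
  obtain ⟨hDmem, hD0, hvan⟩ := hD
  refine ⟨?_, ?_, fun f' hf' => ?_⟩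
  · simp only [Distinguishers, Set.mem_setOf_eq, pow_one] at hDmem ⊢
    exact ⟨(complexity_rename_le_holds' _ D).trans (hDmem.1.trans (centralBinom_mono hnm)),
      (totalDegree_rename_le _ D).trans (hDmem.2.trans (centralBinom_mono hnm))⟩
  · exact fun h0 => hD0 (rename_injective _ (LevelOne.restrict_pad_injective hnm)
      (by rw [h0, map_zero]))
  · obtain ⟨f, hf, hcoeff⟩ := restrict_stretch hn hK hnm hmK f' hf'
    have hvec : coeffVector (degLEMonomials m) f' ∘ (LevelOne.mapsTo_pad hnm).restrict _ _ _ =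
        coeffVector (degLEMonomials n) f := by
      funext μ
      simp only [coeffVector_apply, Function.comp_apply, Set.MapsTo.val_restrict_apply]
      exact (hcoeff μ μ.2).symm
    rw [eval_rename, hvec]
    exact hvan f hf

/-- The padded distinguisher at a padded polynomial: `(rename pad D)(coeff (rename ι g)) =
D(coeff g)` (`coeff_{pad μ} (rename ι g) = coeff_μ g` along the injection `ι`). [folklore] -/
theorem eval_rename_pad {n m : ℕ} (hnm : n ≤ m) (g : MvPolynomial (Fin n) ℂ)
    (D : MvPolynomial (degLEMonomials n) ℂ) :
    eval (coeffVector (degLEMonomials m) (rename (Fin.castLE hnm) g))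
        (rename ((LevelOne.mapsTo_pad hnm).restrict _ _ _) D) =
      eval (coeffVector (degLEMonomials n) g) D := by
  have hvec : coeffVector (degLEMonomials m) (rename (Fin.castLE hnm) g) ∘
      (LevelOne.mapsTo_pad hnm).restrict _ _ _ = coeffVector (degLEMonomials n) g := by
    funext μ
    simp only [coeffVector_apply, Function.comp_apply, Set.MapsTo.val_restrict_apply]
    exact coeff_rename_mapDomain _ (Fin.castLE_injective hnm) g μ
  rw [eval_rename, hvec]

/-! ### The `VNP` side: padding into exponent one -/

/-- **Padding a `VNP`-succinct polynomial into exponent one**: for `n ≤ m` and `n ^ b₁ ≤ m`, a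
member of `SmallDefinable ℂ n b₁` renamed along `Fin n ↪ Fin m` lies in `SmallDefinable ℂ m 1`
(the Boolean sum commutes with renaming, `boolSum_rename_sumMap`; size and degree of the auxiliary
do not grow). [cite: KumarRamyaSaptharishiTengse2022, §1.2] -/
theorem rename_mem_smallDefinable_one {n m b₁ : ℕ} (hnm : n ≤ m) (hm : n ^ b₁ ≤ m)
    {g : MvPolynomial (Fin n) ℂ} (hg : g ∈ SmallDefinable ℂ n b₁) :
    rename (Fin.castLE hnm) g ∈ SmallDefinable ℂ m 1 := by
  obtain ⟨hdeg, u, hu, G, hGc, hGd, rfl⟩ := hg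
  refine ⟨(totalDegree_rename_le _ _).trans (hdeg.trans hnm), u, ?_,
    rename (Sum.map (Fin.castLE hnm) id) G, ?_, ?_, (boolSum_rename_sumMap _ G).symm⟩
  · rw [pow_one]; exact hu.trans hm
  · rw [pow_one]; exact (complexity_rename_le_holds' _ G).trans (hGc.trans hm)
  · rw [pow_one]; exact (totalDegree_rename_le _ G).trans (hGd.trans hm)

/-! ### Exponent collapse -/

/-- **`WinWin.NaturalProofsSeparate b₁ → WinWin.NaturalProofsSeparate 1`.** Given `b'` and `n₀`,
query the hypothesis at `b := K b' + K + 6` (`K = b₁ + 1`) beyond `max n₀ 4`, and stretch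
`n ↦ m = n^K`: the padded distinguisher is a level-one natural proof against `SmallCircuits ℂ m b'`
(`isNaturalProof_rename_pad`), the padded witness lies in `SmallDefinable ℂ m 1`
(`rename_mem_smallDefinable_one`), and the evaluation is unchanged (`eval_rename_pad`).
[cite: ForbesShpilkaVolk2018, Def. 1 and Question 6] -/
theorem separate_one_of_separate {b₁ : ℕ} (h : WinWin.NaturalProofsSeparate b₁) :
    WinWin.NaturalProofsSeparate 1 := by
  intro b' n₀
  obtain ⟨n, hn, D, hD, g, hg, hne⟩ := h ((b₁ + 1) * b' + (b₁ + 1) + 6) (max n₀ 4)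
  have hn₀ : n₀ ≤ n := (le_max_left _ _).trans hn
  have hn4 : 4 ≤ n := (le_max_right _ _).trans hn
  have hK : 1 ≤ b₁ + 1 := Nat.succ_pos b₁
  have hnm : n ≤ n ^ (b₁ + 1) := by
    calc n = n ^ 1 := (pow_one n).symm
      _ ≤ n ^ (b₁ + 1) := Nat.pow_le_pow_right (by omega) hK
  have hm : n ^ b₁ ≤ n ^ (b₁ + 1) := Nat.pow_le_pow_right (by omega) (Nat.le_succ b₁)
  refine ⟨n ^ (b₁ + 1), hn₀.trans hnm, rename ((LevelOne.mapsTo_pad hnm).restrict _ _ _) D,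
    isNaturalProof_rename_pad hn4 hK hnm le_rfl hD, rename (Fin.castLE hnm) g,
    rename_mem_smallDefinable_one hnm hm hg, ?_⟩
  rw [eval_rename_pad]
  exact hne

/-- **Exponent collapse for item 18972**: `NaturalProofsSeparateVNP ↔ WinWin.NaturalProofsSeparate 1`
— the item is decided at definability exponent `b₁ = 1`. [cite: ForbesShpilkaVolk2018, Question 6] -/
theorem naturalProofsSeparateVNP_iff_separate_one :
    BarrierLever.NaturalProofsSeparateVNP ↔ WinWin.NaturalProofsSeparate 1 :=
  ⟨fun ⟨_, h⟩ => separate_one_of_separate h, fun h => ⟨1, h⟩⟩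

/-! ### Tightness: exponent `0` fails, every exponent `≥ 1` is equivalent to the item -/

/-- **A Boolean sum of length `u` costs at most `2^u (L(G) + 1)`**: each of the `2^u` summands
`G(x, e)` is `G` with variables and the constants `0, 1` substituted (cost `≤ L(G)`,
`complexity_aeval_le`), and summing `2^u` polynomials costs `2^u` more gates
(`complexity_finset_sum_le`). [cite: Burgisser2000, Def. 2.5 and §2.1] -/
theorem complexity_boolSum_le {n u : ℕ} (G : MvPolynomial (Fin n ⊕ Fin u) ℂ) :
    complexity (boolSum G) ≤ 2 ^ u * (complexity G + 1) := by
  classical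
  unfold boolSum
  refine (complexity_finset_sum_le _ _).trans ?_
  have hterm : ∀ e : Fin u → Bool,
      complexity (aeval (Sum.elim X fun j => if e j then (1 : MvPolynomial (Fin n) ℂ) else 0) G) ≤
        complexity G := by
    intro e
    refine (complexity_aeval_le G _).trans (le_of_eq ?_)
    rw [Finset.sum_eq_zero fun i _ => ?_, add_zero]
    rcases i with i | j
    · simp only [Sum.elim_inl]
      exact complexity_X_holds i
    · simp only [Sum.elim_inr]
      split_ifs
      · rw [← C_1]; exact complexity_C_holds (1 : ℂ)
      · rw [← C_0]; exact complexity_C_holds (0 : ℂ)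
  calc ∑ e : Fin u → Bool,
        complexity (aeval (Sum.elim X fun j => if e j then (1 : MvPolynomial (Fin n) ℂ) else 0) G) +
        (Finset.univ : Finset (Fin u → Bool)).card
      ≤ ∑ _e : Fin u → Bool, complexity G + (Finset.univ : Finset (Fin u → Bool)).card :=
        Nat.add_le_add_right (Finset.sum_le_sum fun e _ => hterm e) _
    _ = 2 ^ u * (complexity G + 1) := by
        rw [Finset.sum_const, Finset.card_univ, Fintype.card_fun, Fintype.card_bool,
          Fintype.card_fin, smul_eq_mul]
        ring

/-- **Exponent `0` fails**: `¬ WinWin.NaturalProofsSeparate 0` — a member of `SmallDefinable ℂ n 0`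
(Boolean sum of length `≤ 1` of an auxiliary of size `≤ 1`) has complexity `≤ 4 ≤ n`
(`complexity_boolSum_le`), so it lies in `SmallCircuits ℂ n 1` and every natural proof against
that class kills it. Hence `b₁ = 1` in `naturalProofsSeparateVNP_iff_separate_one` is sharp.
[cite: ForbesShpilkaVolk2018, Def. 1] -/
theorem not_separate_zero : ¬ WinWin.NaturalProofsSeparate 0 := by
  intro h
  obtain ⟨n, hn, D, ⟨-, -, hvan⟩, g, hg, hne⟩ := h 1 4
  obtain ⟨hdeg, u, hu, G, hGc, hGd, rfl⟩ := hg
  refine hne (hvan _ ⟨hdeg, ?_⟩)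
  rw [pow_zero] at hu hGc
  calc complexity (boolSum G) ≤ 2 ^ u * (complexity G + 1) := complexity_boolSum_le G
    _ ≤ 2 ^ 1 * (1 + 1) :=
        Nat.mul_le_mul (Nat.pow_le_pow_right Nat.two_pos hu) (Nat.add_le_add_right hGc 1)
    _ ≤ n ^ 1 := by simp only [pow_one]; omega

/-- Monotonicity of the `VNP`-succinct class in its exponent (`n ≥ 1`). [folklore] -/
theorem smallDefinable_mono {n b b' : ℕ} (hn : 1 ≤ n) (h : b ≤ b') :
    SmallDefinable ℂ n b ⊆ SmallDefinable ℂ n b' := by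
  rintro g ⟨hdeg, u, hu, G, hGc, hGd, rfl⟩
  have hp : n ^ b ≤ n ^ b' := Nat.pow_le_pow_right hn h
  exact ⟨hdeg, u, hu.trans hp, G, hGc.trans hp, hGd.trans hp, rfl⟩

/-- Monotonicity of `WinWin.NaturalProofsSeparate` in the exponent. [folklore] -/
theorem separate_mono {b₁ b₁' : ℕ} (h : b₁ ≤ b₁') (hsep : WinWin.NaturalProofsSeparate b₁) :
    WinWin.NaturalProofsSeparate b₁' := by
  intro b n₀
  obtain ⟨n, hn, D, hD, g, hg, hne⟩ := hsep b (max n₀ 1)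
  exact ⟨n, (le_max_left _ _).trans hn, D, hD, g,
    smallDefinable_mono ((le_max_right _ _).trans hn) h hg, hne⟩

/-- **Every exponent `b₁ ≥ 1` is equivalent to the item** (and exponent `0` fails,
`not_separate_zero`): `WinWin.NaturalProofsSeparate b₁ ↔ NaturalProofsSeparateVNP` for `1 ≤ b₁`.
[cite: ForbesShpilkaVolk2018, Question 6] -/
theorem separate_iff_naturalProofsSeparateVNP {b₁ : ℕ} (h : 1 ≤ b₁) :
    WinWin.NaturalProofsSeparate b₁ ↔ BarrierLever.NaturalProofsSeparateVNP :=
  ⟨fun hsep => ⟨b₁, hsep⟩,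
    fun hS => separate_mono h (naturalProofsSeparateVNP_iff_separate_one.mp hS)⟩

/-! ### The item in the barrier catalogue's vocabulary: ONE `VNP`-succinct target family

`Literature.Barriers.ValiantsHypothesis.NaturalProofAgainstVP F a h` is the catalogued technique
class ("for every `b`, infinitely often, a level-`a` natural proof against `SmallCircuits F n b`
nonzero at the target `h n`"), blocked by the crux (`not_naturalProofAgainstVP`). Item 18972 is
exactly the existence of a `VNP`-succinct target family (pointwise in `SmallDefinable ℂ n 1`) with a
level-one natural proof against `VP` — the `∀ b`-dependent witnesses of the item are assembled into
ONE family by choosing, per `n`, the witness at the largest good exponent `≤ n`. -/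

/-- Monotonicity of natural proofs in the size exponent of the simple class (`n ≥ 1`): usefulness
against `SmallCircuits ℂ n b'` implies usefulness against `SmallCircuits ℂ n b` for `b ≤ b'`.
[cite: ForbesShpilkaVolk2018, Def. 1] -/
theorem isNaturalProof_of_le_size {n b b' : ℕ} (hn : 1 ≤ n) (h : b ≤ b')
    {𝒟 : Set (MvPolynomial (degLEMonomials n) ℂ)} {D : MvPolynomial (degLEMonomials n) ℂ}
    (hD : IsNaturalProof (degLEMonomials n) (SmallCircuits ℂ n b') 𝒟 D) :
    IsNaturalProof (degLEMonomials n) (SmallCircuits ℂ n b) 𝒟 D :=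
  ⟨hD.1, hD.2.1, fun f hf => hD.2.2 f (smallCircuits_mono ℂ h hn hf)⟩

/-- **Item 18972 ⟺ a level-one algebraically natural proof against `VP` for SOME target family
that is pointwise `VNP`-succinct (`h n ∈ SmallDefinable ℂ n 1`)** — the item in the vocabulary of the
barrier catalogue (`NaturalProofAgainstVP ℂ 1 h`, FSV's usefulness + constructivity + largeness
for the target `h`). Forward: by exponent collapse work at `b₁ = 1`; per `n`, choose a non-root at
the largest exponent `b ≤ n` carrying a level-one natural proof with a `SmallDefinable ℂ n 1`
non-root (`Nat.findGreatest`; `0` if none, `KRSTResidualBand.zero_mem_smallDefinable`) — monotonicity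
in `b` (`isNaturalProof_of_le_size`) makes
this single family work for every `b`. Backward: take `b₁ = 1` and `g := h n`.
[cite: ForbesShpilkaVolk2018, Def. 1 and Question 2] -/
theorem naturalProofsSeparateVNP_iff_exists_family :
    BarrierLever.NaturalProofsSeparateVNP ↔
      ∃ h : ∀ n, MvPolynomial (Fin n) ℂ,
        (∀ n, h n ∈ SmallDefinable ℂ n 1) ∧ NaturalProofAgainstVP ℂ 1 h := by
  classical
  constructor
  · intro hS
    have h1 : WinWin.NaturalProofsSeparate 1 := naturalProofsSeparateVNP_iff_separate_one.mp hS
    -- the "good exponent" predicate, opaquely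
    obtain ⟨P, hP⟩ : ∃ P : ℕ → ℕ → Prop, ∀ n b, (P n b ↔
        ∃ D, IsNaturalProof (degLEMonomials n) (SmallCircuits ℂ n b) (Distinguishers ℂ n 1) D ∧
          ∃ g ∈ SmallDefinable ℂ n 1, eval (coeffVector (degLEMonomials n) g) D ≠ 0) :=
      ⟨_, fun _ _ => Iff.rfl⟩
    have key : ∀ n : ℕ, ∃ g ∈ SmallDefinable ℂ n 1, ∀ b : ℕ, b ≤ n → 1 ≤ n → P n b →
        ∃ D, IsNaturalProof (degLEMonomials n) (SmallCircuits ℂ n b) (Distinguishers ℂ n 1) D ∧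
          eval (coeffVector (degLEMonomials n) g) D ≠ 0 := by
      intro n
      by_cases hex : ∃ b, b ≤ n ∧ P n b
      · obtain ⟨b₀, hb₀, hP₀⟩ := hex
        obtain ⟨D, hD, g, hg, hne⟩ := (hP n _).1 (Nat.findGreatest_spec (P := P n) hb₀ hP₀)
        exact ⟨g, hg, fun b hb hn hPb =>
          ⟨D, isNaturalProof_of_le_size hn (Nat.le_findGreatest hb hPb) hD, hne⟩⟩
      · exact ⟨0, KRSTResidualBand.zero_mem_smallDefinable n 1,
          fun b hb _ hPb => absurd ⟨b, hb, hPb⟩ hex⟩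
    choose g hg hbest using key
    refine ⟨g, hg, fun b n₀ => ?_⟩
    obtain ⟨n, hn, D, hD, g', hg', hne⟩ := h1 b (max n₀ (max b 1))
    have hbn : b ≤ n := ((le_max_left _ _).trans (le_max_right _ _)).trans hn
    have h1n : 1 ≤ n := ((le_max_right _ _).trans (le_max_right _ _)).trans hn
    obtain ⟨D', hD', hne'⟩ := hbest n b hbn h1n ((hP n b).2 ⟨D, hD, g', hg', hne⟩)
    exact ⟨n, (le_max_left _ _).trans hn, D', hD', hne'⟩
  · rintro ⟨h, hh, hnat⟩
    refine ⟨1, fun b n₀ => ?_⟩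
    obtain ⟨n, hn, D, hD, hne⟩ := hnat b n₀
    exact ⟨n, hn, D, hD, h n, hh n, hne⟩

/-- Hence the catalogued barrier applies to the item verbatim: the crux forbids a level-one natural
proof against `VP` for EVERY target family (`algebraicNaturalProofs_holds`, FSV Thm. 4 / Cor. 5), in
particular for a `VNP`-succinct one — the right-hand side of
`naturalProofsSeparateVNP_iff_exists_family` fails (same content as
`not_naturalProofsSeparateVNP_of_crux`, routed THROUGH the barrier entry `AlgebraicNaturalProofs`).
[cite: ForbesShpilkaVolk2018, Thm. 4 and Cor. 5] -/
theorem not_exists_family_of_crux (hQ : BarrierLever.SuccinctHittingSetsForVP) :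
    ¬ ∃ h : ∀ n, MvPolynomial (Fin n) ℂ,
        (∀ n, h n ∈ SmallDefinable ℂ n 1) ∧ NaturalProofAgainstVP ℂ 1 h := by
  rintro ⟨h, -, hnat⟩
  exact algebraicNaturalProofs_holds ℂ hQ 1 h hnat

end Summit.ValiantsHypothesis.ValiantsHypothesis.Theorems.BarrierLever.NaturalProofsSeparateVNP

end
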